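import Summits.KontsevichZagierPeriods.KontsevichZagierPeriods.Theses.LinRedNormalForm
import Summits.KontsevichZagierPeriods.KontsevichZagierPeriods.Theorems.HoffmanIndependence.Negative.DiagonalAndStrength
import Mathlib.RingTheory.AlgebraTower
import Mathlib.RingTheory.Adjoin.Polynomial.Basic
import Mathlib.Algebra.Polynomial.AlgebraMap
import Mathlib.FieldTheory.IntermediateField.Adjoin.Algebra
import Mathlib.RingTheory.Localization.Module

/-!
# Crux `HoffmanIndependence` (stmt-KontsevichZagierPeriods-15045), line `weight_split` —
# transcendental rescaling (`stub_linearIndependent_mul_pow_iff`)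

For `t` transcendental over `F` inside a commutative `F`-algebra `E` and any family `v : ι → E`,
the products `t ^ m * v i` (`(m, i) : ℕ × ι`) are `F`-linearly independent iff the `v i` are
linearly independent over the ring `F[t] = Algebra.adjoin F {t}`.

* `linearIndependent_adjoin_of_linearIndependent_mul_pow` — (→), valid for every `t`: a relation
  `∑ cᵢ vᵢ = 0` with `cᵢ = Pᵢ(t) ∈ F[t]` expands into a relation among the products `t ^ m * v i`
  whose coefficients are the coefficients of the `Pᵢ`;
* `linearIndependent_mul_pow_of_linearIndependent_adjoin` — (←), for `t` transcendental: the powers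
  `t ^ m` are `F`-linearly independent in `F[t]` (`linearIndependent_pow_of_transcendental`), and
  Mathlib's tower lemma `linearIndependent_smul` multiplies independent families;
* `stub_linearIndependent_mul_pow_iff` — the registered stub (`F = ℚ`, `E = ℝ`), used by the lead
  with `t = π²` to restate the level-one slice of the crux as "`1, ζ(3), ζ(5), …` are linearly
  independent over `ℚ[π²]`";
* `linearIndependent_mul_pow_iff_intermediateField` — the same over the FIELD
  `ℚ(t) = IntermediateField.adjoin ℚ {t}`, the fraction field of `ℚ[t]` inside `ℝ`
  (`IntermediateField.algebraAdjoinAdjoin` scoped instances + `LinearIndependent.iff_fractionRing`).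
-/

noncomputable section

namespace Summit.KontsevichZagierPeriods.LinRedNormalForm.HoffmanIndependence

open Polynomial
open Summit.KontsevichZagierPeriods.HoffmanIndependence.Negative
  (linearIndependent_pow_of_transcendental)

/-- If the products `t ^ m * v i` are `F`-linearly independent then the `v i` are linearly
independent over `F[t] = Algebra.adjoin F {t}` (no hypothesis on `t`): write the coefficients of an
`F[t]`-relation as `Pᵢ(t)` and expand. [folklore] -/
theorem linearIndependent_adjoin_of_linearIndependent_mul_pow {F E ι : Type*} [CommRing F]
    [CommRing E] [Algebra F E] {t : E} {v : ι → E}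
    (h : LinearIndependent F (fun p : ℕ × ι => t ^ p.1 * v p.2)) :
    LinearIndependent (Algebra.adjoin F ({t} : Set E)) v := by
  classical
  rw [linearIndependent_iff']
  intro s g hg i hi
  choose P hP using fun j => Algebra.adjoin_eq_exists_aeval F t (g j)
  set N := s.sup (fun j => (P j).natDegree) + 1
  have hdeg : ∀ j ∈ s, (P j).natDegree < N := fun j hj =>
    Nat.lt_succ_of_le (Finset.le_sup (f := fun j => (P j).natDegree) hj)
  have hexp : ∀ j ∈ s, (g j : E) = ∑ m ∈ Finset.range N, (P j).coeff m • t ^ m := fun j hj => by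
    rw [← hP j, aeval_eq_sum_range' (hdeg j hj)]
  have hrel : ∑ p ∈ Finset.range N ×ˢ s, (P p.2).coeff p.1 • (t ^ p.1 * v p.2) = 0 := by
    rw [Finset.sum_product_right, ← hg]
    refine Finset.sum_congr rfl fun j hj => ?_
    rw [Subalgebra.smul_def, smul_eq_mul, hexp j hj, Finset.sum_mul]
    refine Finset.sum_congr rfl fun m _ => ?_
    rw [smul_mul_assoc]
  have hcoeff :=
    linearIndependent_iff'.1 h (Finset.range N ×ˢ s) (fun p => (P p.2).coeff p.1) hrel
  apply Subtype.ext
  rw [hexp i hi, ZeroMemClass.coe_zero]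
  refine Finset.sum_eq_zero fun m hm => ?_
  rw [hcoeff (m, i) (Finset.mk_mem_product hm hi), zero_smul]

/-- If `t` is transcendental over `F` and the `v i` are linearly independent over
`F[t] = Algebra.adjoin F {t}`, then the products `t ^ m * v i` are `F`-linearly independent: the
powers of `t` are `F`-independent in `F[t]` and independent families multiply along the tower
`F → F[t] → E`. [folklore] -/
theorem linearIndependent_mul_pow_of_linearIndependent_adjoin {F E ι : Type*} [CommRing F]
    [CommRing E] [Algebra F E] {t : E} (ht : Transcendental F t) {v : ι → E}
    (h : LinearIndependent (Algebra.adjoin F ({t} : Set E)) v) :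
    LinearIndependent F (fun p : ℕ × ι => t ^ p.1 * v p.2) := by
  set S := Algebra.adjoin F ({t} : Set E)
  let b : ℕ → S := fun m => ⟨t ^ m, pow_mem (Algebra.self_mem_adjoin_singleton F t) m⟩
  have hb : LinearIndependent F b := by
    refine LinearIndependent.of_comp S.val.toLinearMap ?_
    exact linearIndependent_pow_of_transcendental ht
  exact linearIndependent_smul hb h

/-- **Transcendental rescaling.** For `t ∈ ℝ` transcendental over `ℚ` and any real family `v`, the
products `t ^ m * v i` are `ℚ`-linearly independent iff the `v i` are linearly independent over the
ring `ℚ[t] = Algebra.adjoin ℚ {t}` (whose `ℚ`-basis is `{t ^ m}`). [folklore] -/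
theorem stub_linearIndependent_mul_pow_iff {ι : Type*} {t : ℝ} (ht : Transcendental ℚ t)
    (v : ι → ℝ) :
    LinearIndependent ℚ (fun p : ℕ × ι => t ^ p.1 * v p.2) ↔
      LinearIndependent (Algebra.adjoin ℚ ({t} : Set ℝ)) v :=
  ⟨linearIndependent_adjoin_of_linearIndependent_mul_pow,
    linearIndependent_mul_pow_of_linearIndependent_adjoin ht⟩

/-- **Transcendental rescaling, field version.** For `t ∈ ℝ` transcendental over `ℚ` and any real
family `v`, the products `t ^ m * v i` are `ℚ`-linearly independent iff the `v i` are linearly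
independent over the field `ℚ(t) = IntermediateField.adjoin ℚ {t}`: inside `ℝ`, `ℚ(t)` is the
fraction field of `ℚ[t]`, and linear independence over a domain and over its fraction field agree
(`LinearIndependent.iff_fractionRing`, clearing denominators). [folklore] -/
theorem linearIndependent_mul_pow_iff_intermediateField {ι : Type*} {t : ℝ}
    (ht : Transcendental ℚ t) (v : ι → ℝ) :
    LinearIndependent ℚ (fun p : ℕ × ι => t ^ p.1 * v p.2) ↔
      LinearIndependent (IntermediateField.adjoin ℚ ({t} : Set ℝ)) v := by
  open scoped IntermediateField.algebraAdjoinAdjoin in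
  exact (stub_linearIndependent_mul_pow_iff ht v).trans
    (LinearIndependent.iff_fractionRing (Algebra.adjoin ℚ ({t} : Set ℝ))
      (IntermediateField.adjoin ℚ ({t} : Set ℝ)))

end Summit.KontsevichZagierPeriods.LinRedNormalForm.HoffmanIndependence
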